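import Mathlib
import Summits.MatrixMultiplication.MatrixMultiplication.Theorems.GradedDesignFamily.Negative.GridLaw

/-!
# The σ = 1 shadow of one-subgroup separation
# (crux `LevelGradedCohnUmans.GradedDesignFamily`, stmt-MatrixMultiplication-7610; negative side,
# line `quadratic-extension-level-one-cell`, lead c6)

Let `J ≤ ℂ^G` be a test space closed under two-sided translation (the route's first clause), let the
first set of a `J`-separated triple be (the underlying set of) a finite subgroup `H ≤ G`, and let
`(H, Y, Z)` be `J`-separated in the sense of the route:
for all `x₀ ∈ H`, `z₀ ∈ Z` some `f ∈ J` reads `f(x⁻¹ y y'⁻¹ z) = [x = x₀ ∧ y = y' ∧ z = z₀]` on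
`H × Y × Y × Z`.

* `shadow_separator` — **the shadow.**  Periodising the separator of the target `(1, z₀)` over `H`,
  `F̄(g) := Σ_{h ∈ H} f(h g)`, gives a LEFT-`H`-INVARIANT element of `J` with
  `F̄(y y'⁻¹ z) = [y = y' ∧ z = z₀]` on `Y × Y × Z`:
  the coset `H z₀` is separated from the cosets `H y y'⁻¹ z` of all other words by an `H`-invariant
  test function, i.e. by an element of `J^H ⊆ ℂ[H\G]`.
* `shadow_pair` — the `Y`-only trace (`z = z₀`): `F̄(y y'⁻¹ z₀) = [y = y']` on `Y × Y`.
* `shadow_coset_ne` — consequently no non-trivial word lies in the target coset: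
  `y y'⁻¹ z ∈ H z₀` forces `y = y'` and `z = z₀`.

For the level-one subfield cell (`G = GL₂(𝔽_{q²})`, `H = SL₂(𝔽_q)`, `J = F₁` the frame functions)
`J^H` is the `≈ 2q³`-dimensional space of functions of the `2q` orbit-colourings
`Hg ↦ (H·(g u_t))_{t ∈ P¹(𝔽_{q²})}` of the `≈ q⁵` cosets; over the Baer subline
`b(Hg) = g⁻¹P¹(𝔽_q)` the cosets form `(q+1) × (q−1)` grids `N_G(H)g/H` on which `J^H` restricts to
row-plus-column functions (whence the grid law `GridLaw.lean`), and the `2q − 1` isotypes of `J^H`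
under the grid group are spaces of dimension `≤ q² + 1` over the `q³ + q` sublines.  This lemma is
the formal licence for attacking `stub_subfieldCell` through that finite tomography
(`Cruxes/GradedDesignFamily/Lines/quadratic-extension-level-one-cell-c6.md`).

Sorry-free; axioms `propext`, `Classical.choice`, `Quot.sound`.
-/

set_option linter.dupNamespace false

noncomputable section

open scoped BigOperators

namespace Summit.MatrixMultiplication.MatrixMultiplication.Theorems.GradedDesignFamily.Negative

/-- **The σ = 1 shadow of one-subgroup separation.**  If `J` is closed under two-sided translation,
`X` is the underlying set of the finite subgroup `H`, and `(X, Y, Z)` is `J`-separated in the sense of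
the route, then for every target `z₀ ∈ Z` the `H`-periodised separator
`F̄ = Σ_{h ∈ H} f(h ·)` is a left-`H`-invariant element of `J` reading `[y = y' ∧ z = z₀]` at
`y y'⁻¹ z` for all `y, y' ∈ Y`, `z ∈ Z`. -/
theorem shadow_separator {G : Type} [Group G] [DecidableEq G] (H : Subgroup G) [Fintype H]
    (J : Submodule ℂ (G → ℂ)) (hJ : ∀ f ∈ J, ∀ a b : G, (fun g : G => f (a * g * b)) ∈ J)
    (X Y Z : Finset G) (hX : ∀ x : G, x ∈ X ↔ x ∈ H)
    (hsep : ∀ x₀ ∈ X, ∀ z₀ ∈ Z, ∃ f ∈ J, ∀ x ∈ X, ∀ y ∈ Y, ∀ y' ∈ Y, ∀ z ∈ Z,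
      (x = x₀ ∧ y = y' ∧ z = z₀ → f (x⁻¹ * y * y'⁻¹ * z) = 1) ∧
      (¬ (x = x₀ ∧ y = y' ∧ z = z₀) → f (x⁻¹ * y * y'⁻¹ * z) = 0))
    (z₀ : G) (hz₀ : z₀ ∈ Z) :
    ∃ F ∈ J, (∀ h : G, h ∈ H → ∀ g : G, F (h * g) = F g) ∧
      ∀ y ∈ Y, ∀ y' ∈ Y, ∀ z ∈ Z,
        F (y * y'⁻¹ * z) = if (y = y' ∧ z = z₀) then 1 else 0 := by
  classical
  have h1X : (1 : G) ∈ X := (hX 1).2 H.one_mem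
  obtain ⟨f, hfJ, hf⟩ := hsep 1 h1X z₀ hz₀
  refine ⟨fun g => ∑ h : H, f ((h : G) * g), ?_, ?_, ?_⟩
  · -- membership: a finite sum of left translates of `f`
    have hfun : (fun g => ∑ h : H, f ((h : G) * g)) = ∑ h : H, (fun g : G => f ((h : G) * g * 1)) := by
      funext g
      simp only [Finset.sum_apply, mul_one]
    rw [hfun]
    exact J.sum_mem (fun h _ => hJ f hfJ (h : G) 1)
  · -- left `H`-invariance: reindex the `H`-sum
    intro h₀ hh₀ g
    have e : ∀ h : H, f ((h : G) * (h₀ * g)) = (fun x : G => f (x * g)) ((h : G) * h₀) := by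
      intro h
      simp only [mul_assoc]
    simp only [e]
    exact sum_subgroup_mul_right H (fun x : G => f (x * g)) hh₀
  · -- values on the words `y y'⁻¹ z`
    intro y hy y' hy' z hz
    have hterm : ∀ h : H, f ((h : G) * (y * y'⁻¹ * z)) =
        if ((h : G) = 1 ∧ (y = y' ∧ z = z₀)) then 1 else 0 := by
      intro h
      have hxX : ((h : G)⁻¹) ∈ X := (hX _).2 (H.inv_mem h.2)
      obtain ⟨hone, hzero⟩ := hf ((h : G)⁻¹) hxX y hy y' hy' z hz
      have hw : ((h : G)⁻¹)⁻¹ * y * y'⁻¹ * z = (h : G) * (y * y'⁻¹ * z) := by group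
      rw [hw] at hone hzero
      by_cases hc : ((h : G) = 1 ∧ (y = y' ∧ z = z₀))
      · rw [if_pos hc]
        exact hone ⟨inv_eq_one.2 hc.1, hc.2.1, hc.2.2⟩
      · rw [if_neg hc]
        exact hzero (fun h' => hc ⟨inv_eq_one.1 h'.1, h'.2.1, h'.2.2⟩)
    simp only [hterm]
    by_cases hyz : (y = y' ∧ z = z₀)
    · simp only [hyz, and_true, OneMemClass.coe_eq_one, Finset.sum_ite_eq', Finset.mem_univ,
        if_true, and_self]
    · simp only [hyz, and_false, if_false, Finset.sum_const_zero]

/-- **The `Y`-only trace of the shadow.**  With `z = z₀` the shadow separator reads `[y = y']` at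
`y y'⁻¹ z₀`: the cosets `H y y'⁻¹ z₀` (`y ≠ y'`) are separated from `H z₀` by an `H`-invariant
element of `J` — a condition on `Y` alone (up to the translate `z₀`). -/
theorem shadow_pair {G : Type} [Group G] [DecidableEq G] (H : Subgroup G) [Fintype H]
    (J : Submodule ℂ (G → ℂ)) (hJ : ∀ f ∈ J, ∀ a b : G, (fun g : G => f (a * g * b)) ∈ J)
    (X Y Z : Finset G) (hX : ∀ x : G, x ∈ X ↔ x ∈ H)
    (hsep : ∀ x₀ ∈ X, ∀ z₀ ∈ Z, ∃ f ∈ J, ∀ x ∈ X, ∀ y ∈ Y, ∀ y' ∈ Y, ∀ z ∈ Z,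
      (x = x₀ ∧ y = y' ∧ z = z₀ → f (x⁻¹ * y * y'⁻¹ * z) = 1) ∧
      (¬ (x = x₀ ∧ y = y' ∧ z = z₀) → f (x⁻¹ * y * y'⁻¹ * z) = 0))
    (z₀ : G) (hz₀ : z₀ ∈ Z) :
    ∃ F ∈ J, (∀ h : G, h ∈ H → ∀ g : G, F (h * g) = F g) ∧
      ∀ y ∈ Y, ∀ y' ∈ Y, F (y * y'⁻¹ * z₀) = if y = y' then 1 else 0 := by
  obtain ⟨F, hFJ, hinv, hval⟩ := shadow_separator H J hJ X Y Z hX hsep z₀ hz₀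
  refine ⟨F, hFJ, hinv, fun y hy y' hy' => ?_⟩
  rw [hval y hy y' hy' z₀ hz₀]
  simp only [and_true]

/-- **No non-trivial word in the target coset.**  Under route separation with first set a subgroup
`H`, if `y y'⁻¹ z ∈ H z₀` for `y, y' ∈ Y`, `z, z₀ ∈ Z`, then `y = y'` and `z = z₀`
(so `Z` injects into `H\G`, and `H·(YY⁻¹∖1)·Z` misses every target coset). -/
theorem shadow_coset_ne {G : Type} [Group G] [DecidableEq G] (H : Subgroup G) [Fintype H]
    (J : Submodule ℂ (G → ℂ)) (hJ : ∀ f ∈ J, ∀ a b : G, (fun g : G => f (a * g * b)) ∈ J)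
    (X Y Z : Finset G) (hX : ∀ x : G, x ∈ X ↔ x ∈ H)
    (hsep : ∀ x₀ ∈ X, ∀ z₀ ∈ Z, ∃ f ∈ J, ∀ x ∈ X, ∀ y ∈ Y, ∀ y' ∈ Y, ∀ z ∈ Z,
      (x = x₀ ∧ y = y' ∧ z = z₀ → f (x⁻¹ * y * y'⁻¹ * z) = 1) ∧
      (¬ (x = x₀ ∧ y = y' ∧ z = z₀) → f (x⁻¹ * y * y'⁻¹ * z) = 0))
    (z₀ : G) (hz₀ : z₀ ∈ Z) (y : G) (hy : y ∈ Y) (y' : G) (hy' : y' ∈ Y) (z : G) (hz : z ∈ Z)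
    (h : G) (hh : h ∈ H) (hword : y * y'⁻¹ * z = h * z₀) :
    y = y' ∧ z = z₀ := by
  obtain ⟨F, -, hinv, hval⟩ := shadow_separator H J hJ X Y Z hX hsep z₀ hz₀
  have h1 := hval y hy y' hy' z hz
  have h2 := hval y hy y hy z₀ hz₀
  simp only [and_self, if_true, mul_inv_cancel, one_mul] at h2
  rw [hword, hinv h hh z₀, h2] at h1
  by_contra hc
  rw [if_neg hc] at h1
  exact one_ne_zero h1

end Summit.MatrixMultiplication.MatrixMultiplication.Theorems.GradedDesignFamily.Negative
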